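import Summits.Ventures.PercRepro.C041TriDomTwoCutSide

/-!
# ROW C-041 — THE FAR SIDE OF A 2-CUT, II: THE CHORD AS A HOST EDGE
(p6, gen 46; P6-TWOEXIT-LEAN.md §53 ADDENDUM 18)

THE THROUGH-LEMMA writes the connectivity of `st` between vertices off the far side as connectivity through the
`stOut2S`-edges plus a CHORD `u–v` available in the colours in which `u, v` are connected inside the far side.  If
the host carries an edge `c₀` joining `u` and `v` that is ABSENT in `st`, the chord is realised by `c₀`: three
statuses of the same host — `stOut2S` (no chord), `stChord` (`c₀` free: the chord in the colour of `c₀`) and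
`stDbl` (`c₀` double: the chord in both colours).  The connectivities of `st` between vertices `a, b` off the far
side, for a colouring `ω` with `r := u ~_R v` and `b := u ~_B v` inside the far side:
* `RdS_st_iff_stChord`: red connectivity of `st` is red connectivity of `stChord` at `ω` with `c₀` coloured `r`
  (no condition); `MgS_st_iff_stChord`: blue likewise, when `b ↔ ¬ r` (exactly one colour);
* `RdS_st_iff_stOut2S` / `MgS_st_iff_stOut2S`: without the chord when the colour is missing inside;
* `RdS_st_iff_stDbl` / `MgS_st_iff_stDbl`: with the double chord when the colour is present inside.
The colour of `c₀` is never read by `stOut2S` (`RAdjS_stOut2S_update`), and the connectivities of `stOut2S`,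
`stChord`, `stDbl` read only the edges off the far side (`RdS_stOut2S_congr_out`, …), those of `stIn2S` only the
edges of the far side (`RdS_stIn2S_congr_in`).
-/

namespace PercRepro

namespace ZoneZ

namespace MultiExit

open ZoneData Finset

variable {V₁ E₁ U₁ U₂ : Type} (Z₁ : ZoneData V₁ E₁ U₁ U₂) {st : E₁ → EStat} {u v w : V₁} {c₀ : E₁}

/-- The chord relation is the adjacency through the chord edge. -/
theorem chord_iff_joins (hc : Z₁.Joins c₀ u v) (x y : V₁) : Chord u v x y ↔ Z₁.Joins c₀ x y := by
  rw [joins_iff_of_joins Z₁ hc]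
  unfold Chord
  exact or_comm

/-- The chord edge does not touch the far side. -/
theorem not_InC2S_chord (hwu : w ≠ u) (hwv : w ≠ v) (hc : Z₁.Joins c₀ u v) : ¬ InC2S Z₁ st u v w c₀ := by
  unfold InC2S
  rw [touches_iff_of_joins Z₁ _ hc, not_or]
  exact ⟨u_not_mem_side2 Z₁ hwu hwv, v_not_mem_side2 Z₁ hwu hwv⟩

/-- The chord edge is absent in `stOut2S`. -/
theorem stOut2S_chord (hc₀ : st c₀ = EStat.absent) : stOut2S Z₁ st u v w c₀ = EStat.absent := by
  unfold stOut2S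
  by_cases h : InC2S Z₁ st u v w c₀
  · rw [if_pos h]
  · rw [if_neg h, hc₀]

/-- A free edge of `stOut2S` is off the far side. -/
theorem not_InC2S_of_stOut2S_free {e : E₁} (h : stOut2S Z₁ st u v w e = EStat.free) : ¬ InC2S Z₁ st u v w e := by
  intro he
  unfold stOut2S at h
  rw [if_pos he] at h
  exact absurd h (by decide)

/-- A free edge of `stIn2S` is on the far side. -/
theorem InC2S_of_stIn2S_free {e : E₁} (h : stIn2S Z₁ st u v w e = EStat.free) : InC2S Z₁ st u v w e := by
  by_contra he
  unfold stIn2S at h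
  rw [if_neg he] at h
  exact absurd h (by decide)

/-- Red connectivity of `st` off the far side, when red does not cross the far side: that of `stOut2S`. -/
theorem RdS_st_iff_stOut2S (hwu : w ≠ u) (hwv : w ≠ v) (ω : E₁ → Bool) (hn : ¬ RdS Z₁ (stIn2S Z₁ st u v w) ω u v)
    {a b : V₁} (ha : a ∉ side2 Z₁ st u v w) (hb : b ∉ side2 Z₁ st u v w) :
    RdS Z₁ st ω a b ↔ RdS Z₁ (stOut2S Z₁ st u v w) ω a b := by
  rw [RdS_st_iff_chord Z₁ hwu hwv ω ha hb]
  unfold RdS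
  rw [mem_reach_singleton]
  have hadj : RedChord Z₁ st u v w ω = RAdjS Z₁ (stOut2S Z₁ st u v w) ω := by
    funext x y
    unfold RedChord
    exact propext (or_iff_left fun h => hn h.1)
  rw [hadj]

/-- Blue connectivity of `st` off the far side, when blue does not cross the far side: that of `stOut2S`. -/
theorem MgS_st_iff_stOut2S (hwu : w ≠ u) (hwv : w ≠ v) (ω : E₁ → Bool) (hn : ¬ MgS Z₁ (stIn2S Z₁ st u v w) ω u v)
    {a b : V₁} (ha : a ∉ side2 Z₁ st u v w) (hb : b ∉ side2 Z₁ st u v w) :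
    MgS Z₁ st ω a b ↔ MgS Z₁ (stOut2S Z₁ st u v w) ω a b := by
  rw [MgS_st_iff_chord Z₁ hwu hwv ω ha hb]
  unfold MgS
  rw [mem_reach_singleton]
  have hadj : BlueChord Z₁ st u v w ω = BAdjS Z₁ (stOut2S Z₁ st u v w) ω := by
    funext x y
    unfold BlueChord
    exact propext (or_iff_left fun h => hn h.1)
  rw [hadj]

/-- The connectivities of `stOut2S` read only the edges off the far side. -/
theorem RdS_stOut2S_congr_out {ω ω' : E₁ → Bool} (h : ∀ e, ¬ InC2S Z₁ st u v w e → ω e = ω' e) :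
    RdS Z₁ (stOut2S Z₁ st u v w) ω = RdS Z₁ (stOut2S Z₁ st u v w) ω' :=
  RdS_congr_free Z₁ _ fun e he => h e (not_InC2S_of_stOut2S_free Z₁ he)

/-- The blue connectivities of `stOut2S` read only the edges off the far side. -/
theorem MgS_stOut2S_congr_out {ω ω' : E₁ → Bool} (h : ∀ e, ¬ InC2S Z₁ st u v w e → ω e = ω' e) :
    MgS Z₁ (stOut2S Z₁ st u v w) ω = MgS Z₁ (stOut2S Z₁ st u v w) ω' :=
  MgS_congr_free Z₁ _ fun e he => h e (not_InC2S_of_stOut2S_free Z₁ he)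

/-- The connectivities of `stIn2S` read only the edges of the far side. -/
theorem RdS_stIn2S_congr_in {ω ω' : E₁ → Bool} (h : ∀ e, InC2S Z₁ st u v w e → ω e = ω' e) :
    RdS Z₁ (stIn2S Z₁ st u v w) ω = RdS Z₁ (stIn2S Z₁ st u v w) ω' :=
  RdS_congr_free Z₁ _ fun e he => h e (InC2S_of_stIn2S_free Z₁ he)

/-- The blue connectivities of `stIn2S` read only the edges of the far side. -/
theorem MgS_stIn2S_congr_in {ω ω' : E₁ → Bool} (h : ∀ e, InC2S Z₁ st u v w e → ω e = ω' e) :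
    MgS Z₁ (stIn2S Z₁ st u v w) ω = MgS Z₁ (stIn2S Z₁ st u v w) ω' :=
  MgS_congr_free Z₁ _ fun e he => h e (InC2S_of_stIn2S_free Z₁ he)

variable [DecidableEq E₁]

open Classical in
/-- The far side deleted and the chord edge free. -/
noncomputable def stChord (st : E₁ → EStat) (u v w : V₁) (c₀ : E₁) : E₁ → EStat :=
  fun e => if e = c₀ then EStat.free else stOut2S Z₁ st u v w e

open Classical in
/-- The far side deleted and the chord edge double. -/
noncomputable def stDbl (st : E₁ → EStat) (u v w : V₁) (c₀ : E₁) : E₁ → EStat :=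
  fun e => if e = c₀ then EStat.double else stOut2S Z₁ st u v w e

/-- Red under `stChord`: red under `stOut2S`, or the chord edge coloured red. -/
theorem redE_stChord (hc₀ : st c₀ = EStat.absent) (ω : E₁ → Bool) (e : E₁) :
    redE (stChord Z₁ st u v w c₀) ω e ↔ redE (stOut2S Z₁ st u v w) ω e ∨ (e = c₀ ∧ ω c₀ = true) := by
  unfold stChord
  by_cases h : e = c₀
  · simp [redE, h, stOut2S_chord Z₁ hc₀]
  · simp [redE, h]

/-- Blue under `stChord`: blue under `stOut2S`, or the chord edge coloured blue. -/
theorem blueE_stChord (hc₀ : st c₀ = EStat.absent) (ω : E₁ → Bool) (e : E₁) :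
    blueE (stChord Z₁ st u v w c₀) ω e ↔ blueE (stOut2S Z₁ st u v w) ω e ∨ (e = c₀ ∧ ω c₀ = false) := by
  unfold stChord
  by_cases h : e = c₀
  · simp [blueE, h, stOut2S_chord Z₁ hc₀]
  · simp [blueE, h]

/-- Red under `stDbl`: red under `stOut2S`, or the chord edge. -/
theorem redE_stDbl (hc₀ : st c₀ = EStat.absent) (ω : E₁ → Bool) (e : E₁) :
    redE (stDbl Z₁ st u v w c₀) ω e ↔ redE (stOut2S Z₁ st u v w) ω e ∨ e = c₀ := by
  unfold stDbl
  by_cases h : e = c₀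
  · simp [redE, h, stOut2S_chord Z₁ hc₀]
  · simp [redE, h]

/-- Blue under `stDbl`: blue under `stOut2S`, or the chord edge. -/
theorem blueE_stDbl (hc₀ : st c₀ = EStat.absent) (ω : E₁ → Bool) (e : E₁) :
    blueE (stDbl Z₁ st u v w c₀) ω e ↔ blueE (stOut2S Z₁ st u v w) ω e ∨ e = c₀ := by
  unfold stDbl
  by_cases h : e = c₀
  · simp [blueE, h, stOut2S_chord Z₁ hc₀]
  · simp [blueE, h]

/-! ## The adjacencies -/

/-- The red adjacency of `stChord`: that of `stOut2S`, plus the chord when `c₀` is red. -/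
theorem RAdjS_stChord (hc₀ : st c₀ = EStat.absent) (hc : Z₁.Joins c₀ u v) (ω : E₁ → Bool) (x y : V₁) :
    RAdjS Z₁ (stChord Z₁ st u v w c₀) ω x y ↔ RAdjS Z₁ (stOut2S Z₁ st u v w) ω x y ∨ (ω c₀ = true ∧ Chord u v x y) := by
  rw [RAdjS_eq_AdjCol, RAdjS_eq_AdjCol, chord_iff_joins Z₁ hc]
  constructor
  · rintro ⟨e, hj, he⟩
    rcases (redE_stChord Z₁ hc₀ ω e).mp he with h | ⟨rfl, h⟩
    · exact Or.inl ⟨e, hj, h⟩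
    · exact Or.inr ⟨h, hj⟩
  · rintro (⟨e, hj, he⟩ | ⟨h, hj⟩)
    · exact ⟨e, hj, (redE_stChord Z₁ hc₀ ω e).mpr (Or.inl he)⟩
    · exact ⟨c₀, hj, (redE_stChord Z₁ hc₀ ω c₀).mpr (Or.inr ⟨rfl, h⟩)⟩

/-- The blue adjacency of `stChord`: that of `stOut2S`, plus the chord when `c₀` is blue. -/
theorem BAdjS_stChord (hc₀ : st c₀ = EStat.absent) (hc : Z₁.Joins c₀ u v) (ω : E₁ → Bool) (x y : V₁) :
    BAdjS Z₁ (stChord Z₁ st u v w c₀) ω x y ↔ BAdjS Z₁ (stOut2S Z₁ st u v w) ω x y ∨ (ω c₀ = false ∧ Chord u v x y) := by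
  rw [BAdjS_eq_AdjCol, BAdjS_eq_AdjCol, chord_iff_joins Z₁ hc]
  constructor
  · rintro ⟨e, hj, he⟩
    rcases (blueE_stChord Z₁ hc₀ ω e).mp he with h | ⟨rfl, h⟩
    · exact Or.inl ⟨e, hj, h⟩
    · exact Or.inr ⟨h, hj⟩
  · rintro (⟨e, hj, he⟩ | ⟨h, hj⟩)
    · exact ⟨e, hj, (blueE_stChord Z₁ hc₀ ω e).mpr (Or.inl he)⟩
    · exact ⟨c₀, hj, (blueE_stChord Z₁ hc₀ ω c₀).mpr (Or.inr ⟨rfl, h⟩)⟩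

/-- The red adjacency of `stDbl`: that of `stOut2S`, plus the chord. -/
theorem RAdjS_stDbl (hc₀ : st c₀ = EStat.absent) (hc : Z₁.Joins c₀ u v) (ω : E₁ → Bool) (x y : V₁) :
    RAdjS Z₁ (stDbl Z₁ st u v w c₀) ω x y ↔ RAdjS Z₁ (stOut2S Z₁ st u v w) ω x y ∨ Chord u v x y := by
  rw [RAdjS_eq_AdjCol, RAdjS_eq_AdjCol, chord_iff_joins Z₁ hc]
  constructor
  · rintro ⟨e, hj, he⟩
    rcases (redE_stDbl Z₁ hc₀ ω e).mp he with h | rfl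
    · exact Or.inl ⟨e, hj, h⟩
    · exact Or.inr hj
  · rintro (⟨e, hj, he⟩ | hj)
    · exact ⟨e, hj, (redE_stDbl Z₁ hc₀ ω e).mpr (Or.inl he)⟩
    · exact ⟨c₀, hj, (redE_stDbl Z₁ hc₀ ω c₀).mpr (Or.inr rfl)⟩

/-- The blue adjacency of `stDbl`: that of `stOut2S`, plus the chord. -/
theorem BAdjS_stDbl (hc₀ : st c₀ = EStat.absent) (hc : Z₁.Joins c₀ u v) (ω : E₁ → Bool) (x y : V₁) :
    BAdjS Z₁ (stDbl Z₁ st u v w c₀) ω x y ↔ BAdjS Z₁ (stOut2S Z₁ st u v w) ω x y ∨ Chord u v x y := by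
  rw [BAdjS_eq_AdjCol, BAdjS_eq_AdjCol, chord_iff_joins Z₁ hc]
  constructor
  · rintro ⟨e, hj, he⟩
    rcases (blueE_stDbl Z₁ hc₀ ω e).mp he with h | rfl
    · exact Or.inl ⟨e, hj, h⟩
    · exact Or.inr hj
  · rintro (⟨e, hj, he⟩ | hj)
    · exact ⟨e, hj, (blueE_stDbl Z₁ hc₀ ω e).mpr (Or.inl he)⟩
    · exact ⟨c₀, hj, (blueE_stDbl Z₁ hc₀ ω c₀).mpr (Or.inr rfl)⟩

/-! ## The colours that are never read -/

/-- The red adjacency of `stOut2S` ignores the colour of the (absent) chord edge. -/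
theorem RAdjS_stOut2S_update (hc₀ : st c₀ = EStat.absent) (ω : E₁ → Bool) (b : Bool) :
    RAdjS Z₁ (stOut2S Z₁ st u v w) (Function.update ω c₀ b) = RAdjS Z₁ (stOut2S Z₁ st u v w) ω := by
  apply RAdjS_congr
  intro e
  unfold redE
  by_cases he : e = c₀
  · rw [he, stOut2S_chord Z₁ hc₀]
    simp
  · rw [Function.update_of_ne he]

/-- The blue adjacency of `stOut2S` ignores the colour of the (absent) chord edge. -/
theorem BAdjS_stOut2S_update (hc₀ : st c₀ = EStat.absent) (ω : E₁ → Bool) (b : Bool) :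
    BAdjS Z₁ (stOut2S Z₁ st u v w) (Function.update ω c₀ b) = BAdjS Z₁ (stOut2S Z₁ st u v w) ω := by
  apply BAdjS_congr
  intro e
  unfold blueE
  by_cases he : e = c₀
  · rw [he, stOut2S_chord Z₁ hc₀]
    simp
  · rw [Function.update_of_ne he]

/-! ## The connectivities of `st` as connectivities of the three chord statuses -/

open Classical in
/-- Red connectivity of `st` off the far side: that of `stChord` with `c₀` coloured by the red far connectivity. -/
theorem RdS_st_iff_stChord (hwu : w ≠ u) (hwv : w ≠ v) (hc₀ : st c₀ = EStat.absent) (hc : Z₁.Joins c₀ u v)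
    (ω : E₁ → Bool) {a b : V₁} (ha : a ∉ side2 Z₁ st u v w) (hb : b ∉ side2 Z₁ st u v w) :
    RdS Z₁ st ω a b ↔ RdS Z₁ (stChord Z₁ st u v w c₀)
      (Function.update ω c₀ (decide (RdS Z₁ (stIn2S Z₁ st u v w) ω u v))) a b := by
  rw [RdS_st_iff_chord Z₁ hwu hwv ω ha hb]
  have hadj : RAdjS Z₁ (stChord Z₁ st u v w c₀) (Function.update ω c₀ (decide (RdS Z₁ (stIn2S Z₁ st u v w) ω u v))) =
      RedChord Z₁ st u v w ω := by
    funext x y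
    rw [RAdjS_stChord Z₁ hc₀ hc, RAdjS_stOut2S_update Z₁ hc₀, Function.update_self, decide_eq_true_iff]
    rfl
  show _ ↔ b ∈ ZoneData.reach (RAdjS Z₁ (stChord Z₁ st u v w c₀)
    (Function.update ω c₀ (decide (RdS Z₁ (stIn2S Z₁ st u v w) ω u v)))) {a}
  rw [hadj, mem_reach_singleton]

open Classical in
/-- Blue connectivity of `st` off the far side, when exactly one colour crosses the far side: that of `stChord` with
`c₀` coloured by the red far connectivity. -/
theorem MgS_st_iff_stChord (hwu : w ≠ u) (hwv : w ≠ v) (hc₀ : st c₀ = EStat.absent) (hc : Z₁.Joins c₀ u v)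
    (ω : E₁ → Bool) (hrb : MgS Z₁ (stIn2S Z₁ st u v w) ω u v ↔ ¬ RdS Z₁ (stIn2S Z₁ st u v w) ω u v)
    {a b : V₁} (ha : a ∉ side2 Z₁ st u v w) (hb : b ∉ side2 Z₁ st u v w) :
    MgS Z₁ st ω a b ↔ MgS Z₁ (stChord Z₁ st u v w c₀)
      (Function.update ω c₀ (decide (RdS Z₁ (stIn2S Z₁ st u v w) ω u v))) a b := by
  rw [MgS_st_iff_chord Z₁ hwu hwv ω ha hb]
  have hadj : BAdjS Z₁ (stChord Z₁ st u v w c₀) (Function.update ω c₀ (decide (RdS Z₁ (stIn2S Z₁ st u v w) ω u v))) =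
      BlueChord Z₁ st u v w ω := by
    funext x y
    rw [BAdjS_stChord Z₁ hc₀ hc, BAdjS_stOut2S_update Z₁ hc₀, Function.update_self, decide_eq_false_iff_not, ← hrb]
    rfl
  show _ ↔ b ∈ ZoneData.reach (BAdjS Z₁ (stChord Z₁ st u v w c₀)
    (Function.update ω c₀ (decide (RdS Z₁ (stIn2S Z₁ st u v w) ω u v)))) {a}
  rw [hadj, mem_reach_singleton]

/-- Red connectivity of `st` off the far side, when red crosses the far side: that of `stDbl`. -/
theorem RdS_st_iff_stDbl (hwu : w ≠ u) (hwv : w ≠ v) (hc₀ : st c₀ = EStat.absent) (hc : Z₁.Joins c₀ u v)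
    (ω : E₁ → Bool) (hd : RdS Z₁ (stIn2S Z₁ st u v w) ω u v) {a b : V₁} (ha : a ∉ side2 Z₁ st u v w)
    (hb : b ∉ side2 Z₁ st u v w) : RdS Z₁ st ω a b ↔ RdS Z₁ (stDbl Z₁ st u v w c₀) ω a b := by
  rw [RdS_st_iff_chord Z₁ hwu hwv ω ha hb]
  unfold RdS
  rw [mem_reach_singleton]
  have hadj : RAdjS Z₁ (stDbl Z₁ st u v w c₀) ω = RedChord Z₁ st u v w ω := by
    funext x y
    rw [RAdjS_stDbl Z₁ hc₀ hc]
    unfold RedChord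
    exact propext (or_congr_right (and_iff_right hd).symm)
  rw [hadj]

/-- Blue connectivity of `st` off the far side, when blue crosses the far side: that of `stDbl`. -/
theorem MgS_st_iff_stDbl (hwu : w ≠ u) (hwv : w ≠ v) (hc₀ : st c₀ = EStat.absent) (hc : Z₁.Joins c₀ u v)
    (ω : E₁ → Bool) (hd : MgS Z₁ (stIn2S Z₁ st u v w) ω u v) {a b : V₁} (ha : a ∉ side2 Z₁ st u v w)
    (hb : b ∉ side2 Z₁ st u v w) : MgS Z₁ st ω a b ↔ MgS Z₁ (stDbl Z₁ st u v w c₀) ω a b := by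
  rw [MgS_st_iff_chord Z₁ hwu hwv ω ha hb]
  unfold MgS
  rw [mem_reach_singleton]
  have hadj : BAdjS Z₁ (stDbl Z₁ st u v w c₀) ω = BlueChord Z₁ st u v w ω := by
    funext x y
    rw [BAdjS_stDbl Z₁ hc₀ hc]
    unfold BlueChord
    exact propext (or_congr_right (and_iff_right hd).symm)
  rw [hadj]

end MultiExit

end ZoneZ

end PercRepro
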